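import Summits.QuantumFields.YangMills.Theorems.SwapVirialDeficitSectorLaplaceEndCoreSplit
import HarnessLib

/-!
# LOCALIZATION OF THE TRANSVERSE LETTER ON THE END GAUSS CORE `G♭`: off the excised tube, `B₀(δ,x₀,y₀) ≥ 12τ²` whenever `|u| ≥ τ`
# (stub `stub_core_end`, target `stub_end_gaussCore` of LEAD sfw-p2 g99 22:32Z/22:37Z; free-hands support of ⟨stmt-QuantumFields-24197⟩ `SwapVirialDeficit.SwapGluedStiffness`)

`G♭ = ({end window} ∖ RgCap) ∩ {|u|² ≤ 1 + x₀²}` (✓`endCore_letters_subset_core`).  At a point of `G♭` with `|u| ≥ τ` the excision of `RgCap` leaves two cases — the hub cut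
fails (`τ√(1+δ²) ≤ |δ|` ⟹ `16δ²/(1+δ²) ≥ 16τ²`) or the axial cap fails (`|x₀| > X₁√(1+|u|²) ≥ 1` ⟹ `8x₀²/((1+x₀²)(1+δ²)) ≥ 3`) — so LEAD's `u`-free rate
`B₀ = 16δ²/(1+δ²) + 8x₀²/((1+x₀²)(1+δ²)) + 4y₀²/(1+y₀²)` is `≥ 12τ²` there (`τ ≤ 1/2`): the `u`-Gaussian `e^{−c·B₀|u|²/(1+x₀²+|u|²)}` of ✓`endGauss_exp_three_floor`
LOCALIZES `u` above a polynomial threshold (LEAD 22:22Z (A): «matching to the bulk partner never crosses a stratum»).  Letters as in ✓`endCore_letters_subset_core`.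
* `endGauss_B0_ge_of_hubCut` (`τ√(1+δ²) ≤ |δ|` ⟹ `16τ² ≤ B₀`), `endGauss_B0_ge_of_capFail` (`1 ≤ X₁`, `X₁√(1+|u|²) < |x₀|`, `δ² ≤ 1/3` ⟹ `3 ≤ B₀`),
  ★ `endGaussCore_B0_ge` (on `G♭ ∩ {τ ≤ |u|}`: `12τ² ≤ B₀`, for `0 < τ ≤ 1/2`, `1 ≤ X₁`), `endGaussCore_sq_le` (on `G♭`: `δ² ≤ 4τ/9`, `δ² ≤ 1/3`, `|u|² ≤ 1 + x₀²`).

HONEST LABEL: letter bookkeeping; `stub_core_end` (hG♭: follower half w2, matching∕assembly LEAD) and stubs core-tip ∕ 001-good, ⟨24197⟩ ∕ ⟨24194⟩ and every rung OPEN; own crux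
⟨22884⟩ OPEN (blocked-on ⟨19935⟩); the Yang–Mills mass gap is NOT proved; no summit is proved by a line.  THEOREMS ONLY (0 `def`, 0 `sorry`), standard axioms.
Width seat ym-line-sfw-p2-w3 g67 (cell ym-idea-1, free hands), `--supports stmt-QuantumFields-24197`.  References: [folklore].
-/

set_option autoImplicit false

noncomputable section

open MeasureTheory Quaternion Set
open scoped Quaternion ENNReal BigOperators
open Literature.MathematicalPhysics.QuantumLattice
open Literature.MathematicalPhysics.QuantumFieldTheory hiding SU2

namespace Summit.QuantumFields.YangMills.Theorems.SwapVirialDeficit.BlowUpRing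

variable {L : ℕ}

/-- Hub cut failed ⟹ `16τ² ≤ B₀`: from `τ√(1+δ²) ≤ |δ|` (`τ ≥ 0`), `δ² ≥ τ²(1+δ²)`, so `16δ²/(1+δ²) ≥ 16τ²`. [folklore] -/
theorem endGauss_B0_ge_of_hubCut {δ τ x₀ y₀ : ℝ} (hτ : 0 ≤ τ) (hcut : τ * Real.sqrt (1 + δ ^ 2) ≤ |δ|) :
    16 * τ ^ 2 ≤ 16 * δ ^ 2 / (1 + δ ^ 2) + 8 * x₀ ^ 2 / ((1 + x₀ ^ 2) * (1 + δ ^ 2)) + 4 * y₀ ^ 2 / (1 + y₀ ^ 2) := by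
  have hd : 0 < 1 + δ ^ 2 := by positivity
  have hs : Real.sqrt (1 + δ ^ 2) ^ 2 = 1 + δ ^ 2 := Real.sq_sqrt hd.le
  have h1 : τ ^ 2 * (1 + δ ^ 2) ≤ δ ^ 2 := by
    have h0 : 0 ≤ τ * Real.sqrt (1 + δ ^ 2) := mul_nonneg hτ (Real.sqrt_nonneg _)
    have := pow_le_pow_left₀ h0 hcut 2
    rw [mul_pow, hs, sq_abs] at this
    exact this
  have h2 : 16 * τ ^ 2 ≤ 16 * δ ^ 2 / (1 + δ ^ 2) := by rw [le_div_iff₀ hd]; nlinarith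
  have h3 : 0 ≤ 8 * x₀ ^ 2 / ((1 + x₀ ^ 2) * (1 + δ ^ 2)) := by positivity
  have h4 : 0 ≤ 4 * y₀ ^ 2 / (1 + y₀ ^ 2) := by positivity
  linarith

/-- Axial cap failed ⟹ `3 ≤ B₀`: from `X₁ ≥ 1`, `X₁√(1+|u|²) < |x₀|` and `δ² ≤ 1/3`, `x₀² ≥ 1` and `8x₀²/((1+x₀²)(1+δ²)) ≥ 3`. [folklore] -/
theorem endGauss_B0_ge_of_capFail {δ x₀ y₀ U X₁ : ℝ} (hX : 1 ≤ X₁) (hU : 0 ≤ U) (hcap : X₁ * Real.sqrt (1 + U) < |x₀|) (hδ : δ ^ 2 ≤ 1 / 3) :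
    3 ≤ 16 * δ ^ 2 / (1 + δ ^ 2) + 8 * x₀ ^ 2 / ((1 + x₀ ^ 2) * (1 + δ ^ 2)) + 4 * y₀ ^ 2 / (1 + y₀ ^ 2) := by
  have hd : 0 < 1 + δ ^ 2 := by positivity
  have hx1 : 1 ≤ x₀ ^ 2 := by
    have hs1 : 1 ≤ Real.sqrt (1 + U) := Real.one_le_sqrt.2 (by linarith)
    have h1 : 1 ≤ X₁ * Real.sqrt (1 + U) := by nlinarith
    have h2 : 1 ≤ |x₀| := by linarith
    nlinarith [abs_nonneg x₀, sq_abs x₀]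
  have h2 : 3 ≤ 8 * x₀ ^ 2 / ((1 + x₀ ^ 2) * (1 + δ ^ 2)) := by
    rw [le_div_iff₀ (by positivity)]; nlinarith
  have h3 : 0 ≤ 16 * δ ^ 2 / (1 + δ ^ 2) := by positivity
  have h4 : 0 ≤ 4 * y₀ ^ 2 / (1 + y₀ ^ 2) := by positivity
  linarith

/-- ★ **ON THE END GAUSS CORE `G♭`, OFF THE INNER DISC `|u| < τ`, THE RATE IS `≥ 12τ²`** (`0 < τ ≤ 1/2`, `1 ≤ X₁`; letters of ✓`endCore_letters_subset_core`):
for `p ∈ ({end window} ∖ RgCap(τ, X₁)) ∩ {|u|² ≤ 1+x₀²}` with `τ ≤ √(u₁²+u₂²)`, `12τ² ≤ B₀(p.1, x₀, y₀)`. [folklore] -/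
theorem endGaussCore_B0_ge {τ X₁ : ℝ} (hτ : 0 < τ) (hτ2 : τ ≤ 1 / 2) (hX : 1 ≤ X₁) {p : ℝ × GnoCoord L}
    (hp : p ∈ ({p : ℝ × GnoCoord L | 4 * p.1 ^ 2 / (1 + p.1 ^ 2) ^ 2 < τ ∧ τ ≤ (1 + p.1 ^ 2)⁻¹} \
          ({p : ℝ × GnoCoord L | 4 * p.1 ^ 2 / (1 + p.1 ^ 2) ^ 2 < τ ∧ τ ≤ (1 + p.1 ^ 2)⁻¹ ∧ |p.1| < τ * Real.sqrt (1 + p.1 ^ 2)} ∩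
            {p : ℝ × GnoCoord L | τ ≤ Real.sqrt (p.2.1.1 1 ^ 2 + p.2.1.1 2 ^ 2)} ∩
            {p : ℝ × GnoCoord L | |p.2.1.1 0| ≤ X₁ * Real.sqrt (1 + p.2.1.1 1 ^ 2 + p.2.1.1 2 ^ 2)}) ∩
          {p : ℝ × GnoCoord L | p.2.1.1 1 ^ 2 + p.2.1.1 2 ^ 2 ≤ 1 + p.2.1.1 0 ^ 2}))
    (hu : τ ≤ Real.sqrt (p.2.1.1 1 ^ 2 + p.2.1.1 2 ^ 2)) :
    12 * τ ^ 2 ≤ 16 * p.1 ^ 2 / (1 + p.1 ^ 2) + 8 * (p.2.1.1 0) ^ 2 / ((1 + (p.2.1.1 0) ^ 2) * (1 + p.1 ^ 2)) + 4 * (p.2.1.2 0) ^ 2 / (1 + (p.2.1.2 0) ^ 2) := by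
  obtain ⟨⟨hw, hn⟩, -⟩ := hp
  have hδ : p.1 ^ 2 ≤ 1 / 3 := (endWindow_sq_lt_third hw.1 hw.2).le
  -- not in RgCap: one of the three conditions fails; the middle one holds by `hu`
  simp only [mem_inter_iff, mem_setOf_eq, not_and_or] at hn
  rcases hn with (h1 | h2) | h3
  · -- hub cut fails
    have hcut : τ * Real.sqrt (1 + p.1 ^ 2) ≤ |p.1| := by
      rcases h1 with h | h | h
      · exact absurd hw.1 h
      · exact absurd hw.2 h
      · exact le_of_not_gt h
    have h := endGauss_B0_ge_of_hubCut (x₀ := p.2.1.1 0) (y₀ := p.2.1.2 0) hτ.le hcut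
    nlinarith [sq_nonneg τ]
  · exact absurd hu h2
  · have hcap : X₁ * Real.sqrt (1 + (p.2.1.1 1 ^ 2 + p.2.1.1 2 ^ 2)) < |p.2.1.1 0| := by
      rw [show 1 + (p.2.1.1 1 ^ 2 + p.2.1.1 2 ^ 2) = 1 + p.2.1.1 1 ^ 2 + p.2.1.1 2 ^ 2 by ring]; exact lt_of_not_ge h3
    have h := endGauss_B0_ge_of_capFail (y₀ := p.2.1.2 0) hX (by positivity) hcap hδ
    nlinarith

/-- On `G♭`: `δ² ≤ 4τ/9`, `δ² ≤ 1/3` and `|u|² ≤ 1 + x₀²` (the hypotheses of ✓`endGauss_exp_three_floor` and the slab half-width `s = (2/3)√τ` of ✓`lintegral_endSlab_le`). [folklore] -/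
theorem endGaussCore_sq_le {τ X₁ : ℝ} {p : ℝ × GnoCoord L}
    (hp : p ∈ ({p : ℝ × GnoCoord L | 4 * p.1 ^ 2 / (1 + p.1 ^ 2) ^ 2 < τ ∧ τ ≤ (1 + p.1 ^ 2)⁻¹} \
          ({p : ℝ × GnoCoord L | 4 * p.1 ^ 2 / (1 + p.1 ^ 2) ^ 2 < τ ∧ τ ≤ (1 + p.1 ^ 2)⁻¹ ∧ |p.1| < τ * Real.sqrt (1 + p.1 ^ 2)} ∩
            {p : ℝ × GnoCoord L | τ ≤ Real.sqrt (p.2.1.1 1 ^ 2 + p.2.1.1 2 ^ 2)} ∩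
            {p : ℝ × GnoCoord L | |p.2.1.1 0| ≤ X₁ * Real.sqrt (1 + p.2.1.1 1 ^ 2 + p.2.1.1 2 ^ 2)}) ∩
          {p : ℝ × GnoCoord L | p.2.1.1 1 ^ 2 + p.2.1.1 2 ^ 2 ≤ 1 + p.2.1.1 0 ^ 2})) :
    p.1 ^ 2 ≤ 4 * τ / 9 ∧ p.1 ^ 2 ≤ 1 / 3 ∧ p.2.1.1 1 ^ 2 + p.2.1.1 2 ^ 2 ≤ 1 + p.2.1.1 0 ^ 2 := by
  obtain ⟨⟨hw, -⟩, hcap⟩ := hp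
  exact ⟨endWindow_sq_le hw.1 hw.2, (endWindow_sq_lt_third hw.1 hw.2).le, hcap⟩

end Summit.QuantumFields.YangMills.Theorems.SwapVirialDeficit.BlowUpRing

end
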